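import Summits.AtomisticToContinuum.HydrodynamicLimit.Theorems.InformationPercolationEngineCollisionRateMarginalEnvelopeOfLanfordEnvelope
import Literature.Barriers.AtomisticToContinuum.HighMomentumCutoff
import Summits.AtomisticToContinuum.HydrodynamicLimit.Cruxes.LanfordEnvelopeR.StrategistSketch
import HarnessLib

/-!
# `LanfordEnvelopeR` forces the high-momentum cutoff on every horizon

Strategist r1 (REDIRECT, unit `cstrat-stmt-AtomisticToContinuum-13677-r1`) kernel-checked work file for the crux `Summit.AtomisticToContinuum.HydrodynamicLimit.Theses.BGEndpointRigidity.LanfordEnvelopeR`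
(stmt-AtomisticToContinuum-13677).

The crux asserts, for continuous positive profiles and `0 < σ < σ₀(profiles)`, for EVERY macroscopic horizon `T > 0`, an
order-one Gaussian envelope `|f_N^{(s)}(t)| ≤ C^s e^{-β E_s}` a.e. of ALL volume-marginals of the transported local Gibbs
density, uniformly in `N`, `s` and `t ∈ [0, T]`.

We prove that this envelope implies, profile-wise and for EVERY horizon, the `N`-uniform exponential velocity-moment bound
`sup_N sup_{t ≤ T} E^N_t[(N+1)⁻¹ ∑ᵢ e^{c|vᵢ|²}] < ∞` (`c = β/4`) — i.e. exactly the body of the catalogued barrier statement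
`Literature.Barriers.AtomisticToContinuum.HighMomentumCutoff σ` (Nachtergaele–Yau's unproved Assumption II.1, the "high-momentum
cutoff assumption") at those profiles (`highMomentumCutoffFor_of_lanfordEnvelopeR`, `highMomentumCutoff_iff_forall`).

Consequences recorded for the route's bookkeeping:
* the crux is at least as strong as the barrier's open statement on every horizon, in particular on horizons beyond the
  first shock / focusing time of the guarded Euler solution, where no mechanism for `N`-uniform velocity tails is known;
* the typed disproof target `ExpMomentBlowup` (failure of `N`-uniform exponential velocity moments for one admissible profile,
  all small `σ`) refutes the crux (`not_lanfordEnvelopeR_of_expMomentBlowup`).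

Status: `lean check` rc 0, 0 sorries, axioms {propext, Classical.choice, Quot.sound}. Summits/Theorems is prover-only, so this
file lives in the crux work tree; a prover may land it verbatim under `Theorems/` with `--supports stmt-AtomisticToContinuum-13677`
(namespace `…Theorems.LanfordEnvelopeRStrength`). Companion: `STRATEGY-CENSUS.md` (r1), `RESTATE-REQUEST.md` (§0/§5 here are its Lean).

Ingredients: `C ↦ |C|`; the crux gives `EnvelopeOn`; the landed `stub_labelEnvelopeOn` turns it into the label-set law
envelope `LabelLawEnvelope` of the pushed-forward law; the empirical exponential moment is an average of one-label integrals, each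
dominated by `|C| · ∫ e^{(c-β/2)|v|²} dv dx < ∞`.
-/

noncomputable section

/-! ## §0 Route-file-ready texts of the restate candidates (see §5 and `RESTATE-REQUEST.md`)

Written exactly as they would stand in `Theses/BGEndpointRigidity.lean`: fully qualified, elaborated with only the route file's
`open`s (no `Literature` namespace open) and with the route's items in scope.  §5 identifies them (`Iff.rfl`) with the readable
sketches and proves the weakening chain `LanfordEnvelopeR → LanfordEnvelopeG1 → LanfordEnvelopeG2`. -/

namespace Summit.AtomisticToContinuum.HydrodynamicLimit.Cruxes.LanfordEnvelopeR.StrategistR1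
section RouteText

open scoped BigOperators Topology Manifold Classical MeasureTheory ProbabilityTheory Matrix InnerProductSpace ComplexConjugate ContinuousMap
open Filter Set Function TopologicalSpace MeasureTheory
open Summit.AtomisticToContinuum.HydrodynamicLimit.Theses.BGEndpointRigidity

/-- **Restate candidate G1** (route-file text) = s1's `Strategist.LanfordEnvelopeRGuarded`: the pre-shock, packing-guarded
Lanford envelope — the order-one Gaussian sup bound of all marginals asked only along a classical hard-sphere Euler solution on
`[0,T)` obeying the conjunct's packing guard, for times `r ≤ t < T`, with `(β, C)` chosen after `t` (frame of
`RelEntropyVanishingInBand`). [cite: GST2013, Thm 8 and Prop 6.1.2] -/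
def LanfordEnvelopeG1 : Prop :=
  ∃ η₀ : ℝ, 0 < η₀ ∧ ∀ (a₀ θ₀ : Literature.MathematicalPhysics.KineticTheory.T3 → ℝ) (u₀ : Literature.MathematicalPhysics.KineticTheory.T3 → Literature.MathematicalPhysics.KineticTheory.V3), Continuous a₀ → Continuous θ₀ → Continuous u₀ → (∀ x, 0 < a₀ x) → (∀ x, 0 < θ₀ x) → ∃ σ₀ : ℝ, 0 < σ₀ ∧ ∀ σ : ℝ, 0 < σ → σ < σ₀ → ∀ (T : ℝ) (ρ θ : ℝ → Literature.MathematicalPhysics.KineticTheory.T3 → ℝ) (u : ℝ → Literature.MathematicalPhysics.KineticTheory.T3 → Literature.MathematicalPhysics.KineticTheory.V3), Literature.MathematicalPhysics.KineticTheory.IsHardSphereEulerSolution σ T ρ u θ → (∀ t' ∈ Set.Ico 0 T, ∀ x, ρ t' x * σ ^ 3 < η₀) → ∀ Φ : (N : ℕ) → Literature.Analysis.FluidPDE.HardSphereFlow (Literature.Analysis.FluidPDE.Torus.geometry (Fin 3)) (Literature.MathematicalPhysics.KineticTheory.hsDiameter σ N) (N + 1), Literature.MathematicalPhysics.KineticTheory.TendstoHydroFieldsAt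 (fun N => Literature.MathematicalPhysics.KineticTheory.localGibbsLaw σ a₀ u₀ θ₀ N (Φ N)) Φ ρ u θ 0 → ∀ t ∈ Set.Ico 0 T, ∃ β C : ℝ, 0 < β ∧ ∀ (N : ℕ) (s : ℕ), ∀ r ∈ Set.Icc 0 t, ∀ᵐ Zs : Literature.Analysis.FluidPDE.Config s (Fin 3) Literature.MathematicalPhysics.KineticTheory.T3, |Literature.Analysis.FluidPDE.nthMarginal (N + 1) s ((Literature.Analysis.FluidPDE.hardSphereDomain (Literature.Analysis.FluidPDE.Torus.geometry (Fin 3)) (N + 1) (Literature.MathematicalPhysics.KineticTheory.hsDiameter σ N)).indicator (Literature.Analysis.FluidPDE.hsTransport (Φ N) r (Literature.Analysis.FluidPDE.canonicalDensity (Literature.Analysis.FluidPDE.Torus.geometry (Fin 3)) (Literature.MathematicalPhysics.KineticTheory.hsDiameter σ N) (N + 1) (Literature.MathematicalPhysics.KineticTheory.localGibbsProfile a₀ u₀ θ₀)))) Zs| ≤ C ^ s * Real.exp (-(β * Literature.Analysis.FluidPDE.configEnergy Zs))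

/-- **Restate candidate G2** (route-file text; the FLOOR): same frame, conclusion only Nachtergaele–Yau's high-momentum cutoff —
`N`-uniform exponential velocity moments of the evolved local Gibbs law on `[0,t]`, `t < T` (`expVelocityMoment` inlined because
the route file does not import the barrier module). [cite: NachtergaeleYau2003, §2.3 Assumption II.1] -/
def LanfordEnvelopeG2 : Prop :=
  ∃ η₀ : ℝ, 0 < η₀ ∧ ∀ (a₀ θ₀ : Literature.MathematicalPhysics.KineticTheory.T3 → ℝ) (u₀ : Literature.MathematicalPhysics.KineticTheory.T3 → Literature.MathematicalPhysics.KineticTheory.V3), Continuous a₀ → Continuous θ₀ → Continuous u₀ → (∀ x, 0 < a₀ x) → (∀ x, 0 < θ₀ x) → ∃ σ₀ : ℝ, 0 < σ₀ ∧ ∀ σ : ℝ, 0 < σ → σ < σ₀ → ∀ (T : ℝ) (ρ θ : ℝ → Literature.MathematicalPhysics.KineticTheory.T3 → ℝ) (u : ℝ → Literature.MathematicalPhysics.KineticTheory.T3 → Literature.MathematicalPhysics.KineticTheory.V3), Literature.MathematicalPhysics.KineticTheory.IsHardSphereEulerSolution σ T ρ u θ → (∀ t' ∈ Set.Ico 0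 T, ∀ x, ρ t' x * σ ^ 3 < η₀) → ∀ Φ : (N : ℕ) → Literature.Analysis.FluidPDE.HardSphereFlow (Literature.Analysis.FluidPDE.Torus.geometry (Fin 3)) (Literature.MathematicalPhysics.KineticTheory.hsDiameter σ N) (N + 1), Literature.MathematicalPhysics.KineticTheory.TendstoHydroFieldsAt (fun N => Literature.MathematicalPhysics.KineticTheory.localGibbsLaw σ a₀ u₀ θ₀ N (Φ N)) Φ ρ u θ 0 → ∀ t ∈ Set.Ico 0 T, ∃ c : ℝ, 0 < c ∧ ∃ C : ENNReal, C < ⊤ ∧ ∀ N : ℕ, ∀ r ∈ Set.Icc 0 t, ∫⁻ z, ENNReal.ofReal (((N + 1 : ℕ) : ℝ)⁻¹ * ∑ i, Real.exp (c * ‖((Φ N).flow r z i).2‖ ^ 2)) ∂(Literature.MathematicalPhysics.KineticTheory.localGibbsLaw σ a₀ u₀ θ₀ N (Φ N)) ≤ C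

/-- Re-typed glue (route-file text), K3 := G1: replaces `GronwallBGInBand`. [folklore] -/
def GronwallBGInBandG1 : Prop :=
  LanfordBoltzmannHypothesisR2 → LanfordEnvelopeG1 → RelEntropyVanishingInBand

/-- Re-typed glue (route-file text), K3 := G2. [folklore] -/
def GronwallBGInBandG2 : Prop :=
  LanfordBoltzmannHypothesisR2 → LanfordEnvelopeG2 → RelEntropyVanishingInBand

/-- `glue.lean` for the tenure edit with K3 := G1 (rename to `closes`): the route's deciding theorem, rev-19 proof verbatim,
concluding the sub-problem Statement `_root_.HydrodynamicLimit` BY NAME. [folklore] -/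
theorem closesG1 (_h₀ : RelEntropyVanishingInBand) (hEnv : LanfordEnvelopeG1)
    (_hE : HierarchyEndpointRigidityR) (hBH : LanfordBoltzmannHypothesisR2)
    (hG : GronwallBGInBandG1) : _root_.HydrodynamicLimit := by
  obtain ⟨η₀, hη₀, H⟩ := hG hBH hEnv
  refine ⟨η₀, hη₀, fun a₀ θ₀ u₀ ha hθ hu ha0 hθ0 => ?_⟩
  obtain ⟨σ₀, hσ₀, G⟩ := H a₀ θ₀ u₀ ha hθ hu ha0 hθ0
  refine ⟨σ₀, hσ₀, fun σ hσ hσ' T ρ θ u hsol hguard Φ h0 t ht => ?_⟩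
  obtain ⟨hprob, hmain⟩ := G σ hσ hσ' T ρ θ u hsol hguard Φ
  obtain ⟨a, hψ, hconc, hkl⟩ := hmain h0 t ht
  exact Summit.AtomisticToContinuum.HydrodynamicLimit.Theorems.tendstoHydroFieldsAt_of_klDiv
    (a := a) Φ hconc hkl

/-- `glue.lean` for the tenure edit with K3 := G2. [folklore] -/
theorem closesG2 (_h₀ : RelEntropyVanishingInBand) (hEnv : LanfordEnvelopeG2)
    (_hE : HierarchyEndpointRigidityR) (hBH : LanfordBoltzmannHypothesisR2)
    (hG : GronwallBGInBandG2) : _root_.HydrodynamicLimit := by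
  obtain ⟨η₀, hη₀, H⟩ := hG hBH hEnv
  refine ⟨η₀, hη₀, fun a₀ θ₀ u₀ ha hθ hu ha0 hθ0 => ?_⟩
  obtain ⟨σ₀, hσ₀, G⟩ := H a₀ θ₀ u₀ ha hθ hu ha0 hθ0
  refine ⟨σ₀, hσ₀, fun σ hσ hσ' T ρ θ u hsol hguard Φ h0 t ht => ?_⟩
  obtain ⟨hprob, hmain⟩ := G σ hσ hσ' T ρ θ u hsol hguard Φ
  obtain ⟨a, hψ, hconc, hkl⟩ := hmain h0 t ht
  exact Summit.AtomisticToContinuum.HydrodynamicLimit.Theorems.tendstoHydroFieldsAt_of_klDiv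
    (a := a) Φ hconc hkl

end RouteText
end Summit.AtomisticToContinuum.HydrodynamicLimit.Cruxes.LanfordEnvelopeR.StrategistR1

open scoped BigOperators Topology ENNReal
open MeasureTheory Set Filter Function
open Literature.Analysis.FluidPDE Literature.MathematicalPhysics.KineticTheory
open Literature.Barriers.AtomisticToContinuum (expVelocityMoment expVelocityMoment_eq HighMomentumCutoff)

namespace Summit.AtomisticToContinuum.HydrodynamicLimit.Cruxes.LanfordEnvelopeR.StrategistR1

open Summit.AtomisticToContinuum.HydrodynamicLimit.Theorems.CollisionActivityTailsActivityDomination (Flow Cfg)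
open Summit.AtomisticToContinuum.HydrodynamicLimit.Theorems.CollisionActivityTailsEnvelopePlumbing
  (EnvelopeOn LabelLawEnvelope LabelEnvelopeOn gaussTupleWeight stub_labelEnvelopeOn)

/-! ## §1 The profile-wise high-momentum cutoff -/

/-- **Profile-wise high-momentum cutoff.** The body of `Literature.Barriers.AtomisticToContinuum.HighMomentumCutoff σ` at fixed
profiles `(a₀, u₀, θ₀)`: for every horizon `T > 0` and every family of hard-sphere flows, some exponential velocity moment of the
evolved local Gibbs state is bounded uniformly in `N` and `t ∈ [0, T]`. [cite: NachtergaeleYau2003, §2.3 Assumption II.1] -/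
def HighMomentumCutoffFor (σ : ℝ) (a₀ θ₀ : T3 → ℝ) (u₀ : T3 → V3) : Prop :=
  ∀ T : ℝ, 0 < T → ∀ Φ : (N : ℕ) → HardSphereFlow (Torus.geometry (Fin 3)) (hsDiameter σ N) (N + 1),
    ∃ c : ℝ, 0 < c ∧ ∃ C : ℝ≥0∞, C < ∞ ∧ ∀ N : ℕ, ∀ t ∈ Icc 0 T,
      ∫⁻ z, expVelocityMoment c ((Φ N).flow t z) ∂(localGibbsLaw σ a₀ u₀ θ₀ N (Φ N)) ≤ C

/-- The barrier statement is the profile-wise cutoff for all admissible profiles (unfolding). [cite: NachtergaeleYau2003, §2.3 Assumption II.1] -/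
theorem highMomentumCutoff_iff_forall (σ : ℝ) :
    HighMomentumCutoff σ ↔ ∀ (a₀ θ₀ : T3 → ℝ) (u₀ : T3 → V3), Continuous a₀ → Continuous θ₀ → Continuous u₀ →
      (∀ x, 0 < a₀ x) → (∀ x, 0 < θ₀ x) → HighMomentumCutoffFor σ a₀ θ₀ u₀ :=
  Iff.rfl

/-- Negated form of the profile-wise cutoff (for refuters): some horizon and flow family along which every exponential velocity
moment is unbounded in `N`. [folklore] -/
theorem not_highMomentumCutoffFor_iff (σ : ℝ) (a₀ θ₀ : T3 → ℝ) (u₀ : T3 → V3) :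
    ¬ HighMomentumCutoffFor σ a₀ θ₀ u₀ ↔
      ∃ T : ℝ, 0 < T ∧ ∃ Φ : (N : ℕ) → HardSphereFlow (Torus.geometry (Fin 3)) (hsDiameter σ N) (N + 1),
        ∀ c : ℝ, 0 < c → ∀ C : ℝ≥0∞, C < ∞ → ∃ N : ℕ, ∃ t ∈ Icc 0 T,
          C < ∫⁻ z, expVelocityMoment c ((Φ N).flow t z) ∂(localGibbsLaw σ a₀ u₀ θ₀ N (Φ N)) := by
  unfold HighMomentumCutoffFor
  push Not
  exact Iff.rfl

/-! ## §2 Measure-theoretic lemmas -/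

/-- The empirical exponential velocity moment is measurable. [folklore] -/
theorem measurable_expVelocityMoment (c : ℝ) (N : ℕ) :
    Measurable fun z : Cfg N => expVelocityMoment c z := by
  have hc : Continuous fun z : Cfg N => ((N + 1 : ℕ) : ℝ)⁻¹ * ∑ i, Real.exp (c * ‖(z i).2‖ ^ 2) := by
    refine continuous_const.mul (continuous_finsetSum _ fun i _ => ?_)
    exact Real.continuous_exp.comp (continuous_const.mul ((continuous_norm.comp
      (continuous_snd.comp (continuous_apply i))).pow 2))
  show Measurable fun z : Cfg N => ENNReal.ofReal (((N + 1 : ℕ) : ℝ)⁻¹ * ∑ i, Real.exp (c * ‖(z i).2‖ ^ 2))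
  exact (ENNReal.continuous_ofReal.comp hc).measurable

/-- One summand of the empirical exponential moment is measurable. [folklore] -/
theorem measurable_expTerm (c : ℝ) (N : ℕ) (i : Fin (N + 1)) :
    Measurable fun w : Cfg N => ENNReal.ofReal (Real.exp (c * ‖(w i).2‖ ^ 2)) :=
  (Real.measurable_exp.comp (((measurable_pi_apply i).snd.norm.pow_const 2).const_mul c)).ennreal_ofReal

/-- The one-label test function `q ↦ e^{c |v(q₀)|²}` is measurable. [folklore] -/
theorem measurable_labelTest (c : ℝ) :
    Measurable fun q : Fin 1 → T3 × V3 => ENNReal.ofReal (Real.exp (c * ‖(q 0).2‖ ^ 2)) :=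
  (Real.measurable_exp.comp (((measurable_pi_apply 0).snd.norm.pow_const 2).const_mul c)).ennreal_ofReal

/-- The empirical exponential moment as an average of `ofReal` summands. [folklore] -/
theorem expVelocityMoment_eq_inv_mul_sum (c : ℝ) {N : ℕ} (w : Cfg N) :
    expVelocityMoment c w = ((N + 1 : ℕ) : ℝ≥0∞)⁻¹ * ∑ i, ENNReal.ofReal (Real.exp (c * ‖(w i).2‖ ^ 2)) := by
  rw [expVelocityMoment_eq, ENNReal.ofReal_mul (inv_nonneg.2 (Nat.cast_nonneg _)),
    ENNReal.ofReal_inv_of_pos (Nat.cast_pos.2 (Nat.succ_pos N)), ENNReal.ofReal_natCast,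
    ENNReal.ofReal_sum_of_nonneg fun i _ => (Real.exp_pos _).le]

/-- Real Gaussians are integrable on `ℝ³`. [folklore] -/
theorem integrable_exp_neg_mul_sq_norm_V3 {b : ℝ} (hb : 0 < b) :
    Integrable (fun v : V3 => Real.exp (-b * ‖v‖ ^ 2)) := by
  by_contra h
  have h1 := GaussianFourier.integral_rexp_neg_mul_sq_norm (V := V3) hb
  rw [integral_undef h] at h1
  have h2 : (0 : ℝ) < (Real.pi / b) ^ ((Module.finrank ℝ V3 : ℝ) / 2) := by positivity
  linarith

/-- The one-label Gaussian reference constant `∫ e^{β|v|²/4} e^{-β|v|²/2} dv dx` of the label-set envelope. [folklore] -/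
def labelGaussConst (β : ℝ) : ℝ≥0∞ :=
  ∫⁻ q : Fin 1 → T3 × V3, ENNReal.ofReal (Real.exp (β / 4 * ‖(q 0).2‖ ^ 2)) * gaussTupleWeight β q

/-- The one-label Gaussian reference constant is finite for `β > 0`. [folklore] -/
theorem labelGaussConst_lt_top {β : ℝ} (hβ : 0 < β) : labelGaussConst β < ∞ := by
  have hpt : ∀ q : Fin 1 → T3 × V3,
      ENNReal.ofReal (Real.exp (β / 4 * ‖(q 0).2‖ ^ 2)) * gaussTupleWeight β q =
        ENNReal.ofReal (Real.exp (-(β / 4) * ‖(q 0).2‖ ^ 2)) := by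
    intro q
    rw [gaussTupleWeight, ← ENNReal.ofReal_mul (Real.exp_pos _).le, ← Real.exp_add]
    congr 2
    simp only [Fin.sum_univ_one]
    ring
  have hg : Measurable fun z : T3 × V3 => ENNReal.ofReal (Real.exp (-(β / 4) * ‖z.2‖ ^ 2)) :=
    (Real.measurable_exp.comp ((measurable_snd.norm.pow_const 2).const_mul _)).ennreal_ofReal
  have h1 : ∫⁻ q : Fin 1 → T3 × V3, ENNReal.ofReal (Real.exp (-(β / 4) * ‖(q 0).2‖ ^ 2)) =
      ∫⁻ z : T3 × V3, ENNReal.ofReal (Real.exp (-(β / 4) * ‖z.2‖ ^ 2)) := by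
    rw [← (volume_preserving_funUnique (Fin 1) (T3 × V3)).lintegral_comp hg]
    rfl
  have h2 : ∫⁻ z : T3 × V3, ENNReal.ofReal (Real.exp (-(β / 4) * ‖z.2‖ ^ 2)) =
      volume (univ : Set T3) * ∫⁻ v : V3, ENNReal.ofReal (Real.exp (-(β / 4) * ‖v‖ ^ 2)) := by
    rw [Measure.volume_eq_prod, lintegral_prod _ hg.aemeasurable]
    simp only [lintegral_const]
    rw [mul_comm]
  unfold labelGaussConst
  simp_rw [hpt]
  rw [h1, h2]
  exact ENNReal.mul_lt_top (measure_lt_top _ _)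
    (integrable_exp_neg_mul_sq_norm_V3 (by positivity : 0 < β / 4)).lintegral_lt_top

/-! ## §3 The bridge -/

/-- **Core estimate: marginal envelope ⇒ uniform exponential velocity moments.** For continuous positive profiles,
`0 < σ < ½`, a flow family `Φ`, a horizon `τ` and an envelope `EnvelopeOn σ a₀ θ₀ u₀ Φ τ β C` (a.e. bounds
`|f_N^{(k)}(r)| ≤ C^k e^{-β E_k}` of all volume-marginals, `r ∈ [0, τ]`), the evolved local Gibbs law has
`E^N_t[(N+1)⁻¹ ∑ᵢ e^{β|vᵢ|²/4}] ≤ |C| · ∫ e^{-β|v|²/4} dv dx` for all `N` and `t ∈ [0, τ]`: `C ↦ |C|`, the landed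
`stub_labelEnvelopeOn` (label-set law envelope of the pushed-forward law), and the one-label bound averaged over labels. [folklore] -/
theorem lintegral_expVelocityMoment_le_of_envelopeOn {a₀ θ₀ : T3 → ℝ} {u₀ : T3 → V3}
    (ha : Continuous a₀) (hθ : Continuous θ₀) (hu : Continuous u₀) (ha0 : ∀ x, 0 < a₀ x) (hθ0 : ∀ x, 0 < θ₀ x)
    {σ : ℝ} (hσ : 0 < σ) (hσ2 : σ < 2⁻¹) (Φ : (N : ℕ) → Flow σ N) {τ β C : ℝ}
    (hE : EnvelopeOn σ a₀ θ₀ u₀ Φ τ β C) (N : ℕ) {t : ℝ} (ht : t ∈ Icc 0 τ) :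
    ∫⁻ z, expVelocityMoment (β / 4) ((Φ N).flow t z) ∂(localGibbsLaw σ a₀ u₀ θ₀ N (Φ N)) ≤
      ENNReal.ofReal |C| * labelGaussConst β := by
  have hE' : EnvelopeOn σ a₀ θ₀ u₀ Φ τ β |C| := by
    intro N k r hr
    filter_upwards [hE N k r hr] with Zk hZ
    exact hZ.trans (mul_le_mul_of_nonneg_right ((le_abs_self _).trans_eq (abs_pow C k)) (Real.exp_pos _).le)
  obtain ⟨hLab, -⟩ := stub_labelEnvelopeOn a₀ θ₀ u₀ ha hθ hu ha0 hθ0 σ hσ hσ2 Φ τ β |C| (abs_nonneg C) hE'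
  have hlaw : LabelLawEnvelope ((localGibbsLaw σ a₀ u₀ θ₀ N (Φ N)).map ((Φ N).flow t)) |C| β := hLab N t ht
  -- one-label bound from the label-set envelope with `m = 1`
  have hlabel : ∀ i : Fin (N + 1),
      ∫⁻ w, ENNReal.ofReal (Real.exp (β / 4 * ‖(w i).2‖ ^ 2)) ∂((localGibbsLaw σ a₀ u₀ θ₀ N (Φ N)).map ((Φ N).flow t)) ≤
        ENNReal.ofReal |C| * labelGaussConst β := by
    intro i
    have h := hlaw 1 ⟨fun _ => i, fun a b _ => Subsingleton.elim a b⟩ _ (measurable_labelTest (β / 4))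
    simpa [labelGaussConst] using h
  have hn : ((N + 1 : ℕ) : ℝ≥0∞) ≠ 0 := by exact_mod_cast Nat.succ_ne_zero N
  have hn' : ((N + 1 : ℕ) : ℝ≥0∞) ≠ ∞ := ENNReal.natCast_ne_top _
  rw [← lintegral_map (measurable_expVelocityMoment (β / 4) N) ((Φ N).measurable_flow t)]
  simp_rw [expVelocityMoment_eq_inv_mul_sum]
  rw [lintegral_const_mul' _ _ (ENNReal.inv_ne_top.2 hn), lintegral_finsetSum _ fun i _ => measurable_expTerm (β / 4) N i]
  calc ((N + 1 : ℕ) : ℝ≥0∞)⁻¹ * ∑ i, ∫⁻ w, ENNReal.ofReal (Real.exp (β / 4 * ‖(w i).2‖ ^ 2))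
          ∂((localGibbsLaw σ a₀ u₀ θ₀ N (Φ N)).map ((Φ N).flow t))
      ≤ ((N + 1 : ℕ) : ℝ≥0∞)⁻¹ * ∑ _i : Fin (N + 1), ENNReal.ofReal |C| * labelGaussConst β := by
        gcongr with i
        exact hlabel i
    _ = ENNReal.ofReal |C| * labelGaussConst β := by
        rw [Finset.sum_const, Finset.card_univ, Fintype.card_fin, nsmul_eq_mul, ← mul_assoc,
          ENNReal.inv_mul_cancel hn hn', one_mul]

/-- **`LanfordEnvelopeR` ⇒ high-momentum cutoff on every horizon.** For continuous positive profiles, the crux's order-one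
Gaussian envelope of all marginals gives, for `0 < σ < min σ₀ ½`, EVERY horizon `T > 0` and every flow family `Φ`, the `N`-uniform
bound `E^N_t[(N+1)⁻¹ ∑ᵢ e^{β|vᵢ|²/4}] ≤ |C| · ∫ e^{-β|v|²/4} dv dx < ∞` for all `N` and `t ∈ [0, T]` — the body of
Nachtergaele–Yau's (unproved) cutoff assumption II.1 at these profiles, with no restriction to pre-shock times. [cite: NachtergaeleYau2003, §2.3 Assumption II.1] -/
theorem highMomentumCutoffFor_of_lanfordEnvelopeR
    (hL : Summit.AtomisticToContinuum.HydrodynamicLimit.Theses.BGEndpointRigidity.LanfordEnvelopeR) :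
    ∀ (a₀ θ₀ : T3 → ℝ) (u₀ : T3 → V3), Continuous a₀ → Continuous θ₀ → Continuous u₀ →
      (∀ x, 0 < a₀ x) → (∀ x, 0 < θ₀ x) → ∃ σ₀ : ℝ, 0 < σ₀ ∧ ∀ σ : ℝ, 0 < σ → σ < σ₀ →
        HighMomentumCutoffFor σ a₀ θ₀ u₀ := by
  intro a₀ θ₀ u₀ ha hθ hu ha0 hθ0
  obtain ⟨σ₁, hσ₁, hL1⟩ := hL a₀ θ₀ u₀ ha hθ hu ha0 hθ0
  refine ⟨min σ₁ 2⁻¹, lt_min hσ₁ (by norm_num), fun σ hσ hσlt T hT Φ => ?_⟩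
  obtain ⟨β, C, hβ, hB⟩ := hL1 σ hσ (hσlt.trans_le (min_le_left _ _)) T hT
  have hE : EnvelopeOn σ a₀ θ₀ u₀ Φ T β C := fun N k r hr => hB N (Φ N) k r hr
  exact ⟨β / 4, by positivity, ENNReal.ofReal |C| * labelGaussConst β,
    ENNReal.mul_lt_top ENNReal.ofReal_lt_top (labelGaussConst_lt_top hβ), fun N t ht =>
      lintegral_expVelocityMoment_le_of_envelopeOn ha hθ hu ha0 hθ0 hσ (hσlt.trans_le (min_le_right _ _)) Φ hE N ht⟩

/-- The crux implies the barrier's cutoff statement read through `highMomentumCutoff_iff_forall`, profile by profile: for every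
admissible profile there is `σ₀ > 0` below which the Nachtergaele–Yau cutoff holds on every horizon. [cite: NachtergaeleYau2003, §2.3 Assumption II.1] -/
theorem lanfordEnvelopeR_strength :
    Summit.AtomisticToContinuum.HydrodynamicLimit.Theses.BGEndpointRigidity.LanfordEnvelopeR →
    ∀ (a₀ θ₀ : T3 → ℝ) (u₀ : T3 → V3), Continuous a₀ → Continuous θ₀ → Continuous u₀ →
      (∀ x, 0 < a₀ x) → (∀ x, 0 < θ₀ x) → ∃ σ₀ : ℝ, 0 < σ₀ ∧ ∀ σ : ℝ, 0 < σ → σ < σ₀ →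
      ∀ T : ℝ, 0 < T → ∀ Φ : (N : ℕ) → HardSphereFlow (Torus.geometry (Fin 3)) (hsDiameter σ N) (N + 1),
        ∃ c : ℝ, 0 < c ∧ ∃ C : ℝ≥0∞, C < ∞ ∧ ∀ N : ℕ, ∀ t ∈ Icc 0 T,
          ∫⁻ z, expVelocityMoment c ((Φ N).flow t z) ∂(localGibbsLaw σ a₀ u₀ θ₀ N (Φ N)) ≤ C :=
  highMomentumCutoffFor_of_lanfordEnvelopeR

/-! ## §4 The typed disproof target -/

/-- **Exponential-moment blow-up** (typed disproof target for the crux): one admissible profile for which, for all small `σ`,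
the `N`-uniform exponential velocity-moment bound fails on some horizon along some flow family — the expected signature of
converging-shock (Guderley) focusing of smooth large data past the first shock time. [folklore] -/
def ExpMomentBlowup : Prop :=
  ∃ (a₀ θ₀ : T3 → ℝ) (u₀ : T3 → V3), Continuous a₀ ∧ Continuous θ₀ ∧ Continuous u₀ ∧ (∀ x, 0 < a₀ x) ∧ (∀ x, 0 < θ₀ x) ∧
    ∀ σ₀ : ℝ, 0 < σ₀ → ∃ σ : ℝ, 0 < σ ∧ σ < σ₀ ∧ ¬ HighMomentumCutoffFor σ a₀ θ₀ u₀

/-- Exponential-moment blow-up refutes the crux. [folklore] -/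
theorem not_lanfordEnvelopeR_of_expMomentBlowup (h : ExpMomentBlowup) :
    ¬ Summit.AtomisticToContinuum.HydrodynamicLimit.Theses.BGEndpointRigidity.LanfordEnvelopeR := by
  intro hL
  obtain ⟨a₀, θ₀, u₀, ha, hθ, hu, ha0, hθ0, hbad⟩ := h
  obtain ⟨σ₀, hσ₀, hgood⟩ := highMomentumCutoffFor_of_lanfordEnvelopeR hL a₀ θ₀ u₀ ha hθ hu ha0 hθ0
  obtain ⟨σ, hσ, hσlt, hno⟩ := hbad σ₀ hσ₀
  exact hno (hgood σ hσ hσlt)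

/-! ## §5 Restate candidates: readable forms, identification with §0, and the PROVED weakening chain -/

open Summit.AtomisticToContinuum.HydrodynamicLimit.Theses.BGEndpointRigidity
  (LanfordEnvelopeR RelEntropyVanishingInBand LanfordBoltzmannHypothesisR2 GronwallBGInBand)
open Summit.AtomisticToContinuum.HydrodynamicLimit.Cruxes.LanfordEnvelopeR.Strategist
  (LanfordEnvelopeRGuarded guarded_of_lanfordEnvelopeR)

/-- **G2 readable — guarded high-momentum cutoff.** Same frame as s1's `LanfordEnvelopeRGuarded` (classical hard-sphere Euler
solution on `[0,T)`, packing guard, hydrodynamic convergence at `t = 0`); the conclusion is only Nachtergaele–Yau's cutoff on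
`[0,t]`, `t < T`. [cite: NachtergaeleYau2003, §2.3 Assumption II.1] -/
def HighMomentumCutoffGuarded : Prop :=
  ∃ η₀ : ℝ, 0 < η₀ ∧ ∀ (a₀ θ₀ : T3 → ℝ) (u₀ : T3 → V3), Continuous a₀ → Continuous θ₀ → Continuous u₀ →
    (∀ x, 0 < a₀ x) → (∀ x, 0 < θ₀ x) → ∃ σ₀ : ℝ, 0 < σ₀ ∧ ∀ σ : ℝ, 0 < σ → σ < σ₀ →
      ∀ (T : ℝ) (ρ θ : ℝ → T3 → ℝ) (u : ℝ → T3 → V3), IsHardSphereEulerSolution σ T ρ u θ →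
        (∀ t' ∈ Ico 0 T, ∀ x, ρ t' x * σ ^ 3 < η₀) →
        ∀ Φ : (N : ℕ) → HardSphereFlow (Torus.geometry (Fin 3)) (hsDiameter σ N) (N + 1),
          TendstoHydroFieldsAt (fun N => localGibbsLaw σ a₀ u₀ θ₀ N (Φ N)) Φ ρ u θ 0 →
            ∀ t ∈ Ico 0 T, ∃ c : ℝ, 0 < c ∧ ∃ C : ℝ≥0∞, C < ∞ ∧
              ∀ N : ℕ, ∀ r ∈ Icc 0 t,
                ∫⁻ z, expVelocityMoment c ((Φ N).flow r z) ∂(localGibbsLaw σ a₀ u₀ θ₀ N (Φ N)) ≤ C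

/-- The route-file text G1 IS s1's guarded envelope (syntactic identity up to unfolding `evolvedMarginal`). [folklore] -/
theorem lanfordEnvelopeG1_iff : LanfordEnvelopeG1 ↔ LanfordEnvelopeRGuarded := Iff.rfl

/-- The route-file text G2 IS the guarded cutoff (unfolding `expVelocityMoment`). [folklore] -/
theorem lanfordEnvelopeG2_iff : LanfordEnvelopeG2 ↔ HighMomentumCutoffGuarded := Iff.rfl

/-- `G1 → G2`: the guarded sup envelope gives the guarded cutoff (core estimate §3, with `σ₀ ↦ min σ₀ ½`). [folklore] -/
theorem cutoffGuarded_of_guarded (h : LanfordEnvelopeRGuarded) : HighMomentumCutoffGuarded := by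
  obtain ⟨η₀, hη₀, H⟩ := h
  refine ⟨η₀, hη₀, fun a₀ θ₀ u₀ ha hθ hu ha0 hθ0 => ?_⟩
  obtain ⟨σ₁, hσ₁, H1⟩ := H a₀ θ₀ u₀ ha hθ hu ha0 hθ0
  refine ⟨min σ₁ 2⁻¹, lt_min hσ₁ (by norm_num), fun σ hσ hσlt T ρ θ u hsol hguard Φ h0 t ht => ?_⟩
  obtain ⟨β, C, hβ, hB⟩ := H1 σ hσ (hσlt.trans_le (min_le_left _ _)) T ρ θ u hsol hguard Φ h0 t ht
  have hE : EnvelopeOn σ a₀ θ₀ u₀ Φ t β C := fun N k r hr => hB N k r hr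
  exact ⟨β / 4, by positivity, ENNReal.ofReal |C| * labelGaussConst β,
    ENNReal.mul_lt_top ENNReal.ofReal_lt_top (labelGaussConst_lt_top hβ), fun N r hr =>
      lintegral_expVelocityMoment_le_of_envelopeOn ha hθ hu ha0 hθ0 hσ (hσlt.trans_le (min_le_right _ _)) Φ hE N hr⟩

/-- The full chain from the crux as typed: `LanfordEnvelopeR → G1 → G2`. [folklore] -/
theorem cutoffGuarded_of_lanfordEnvelopeR (h : LanfordEnvelopeR) : HighMomentumCutoffGuarded :=
  cutoffGuarded_of_guarded (guarded_of_lanfordEnvelopeR h)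

/-- Weakening certificate for a 1:1 `--restate` to G1. [folklore] -/
theorem lanfordEnvelopeG1_of_R (h : LanfordEnvelopeR) : LanfordEnvelopeG1 :=
  lanfordEnvelopeG1_iff.2 (guarded_of_lanfordEnvelopeR h)

/-- Weakening certificate for a 1:1 `--restate` to G2. [folklore] -/
theorem lanfordEnvelopeG2_of_R (h : LanfordEnvelopeR) : LanfordEnvelopeG2 :=
  lanfordEnvelopeG2_iff.2 (cutoffGuarded_of_lanfordEnvelopeR h)

/-- Honest cost of the restate: the re-typed glue items are (weakly) HARDER — `G2`-glue ⇒ `G1`-glue ⇒ present glue. [folklore] -/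
theorem gronwallBGInBandG1_of_G2 (h : GronwallBGInBandG2) : GronwallBGInBandG1 :=
  fun hBH hEnv => h hBH (lanfordEnvelopeG2_iff.2 (cutoffGuarded_of_guarded (lanfordEnvelopeG1_iff.1 hEnv)))

theorem gronwallBGInBand_of_G1 (h : GronwallBGInBandG1) : GronwallBGInBand :=
  fun hBH hEnv => h hBH (lanfordEnvelopeG1_of_R hEnv)

end Summit.AtomisticToContinuum.HydrodynamicLimit.Cruxes.LanfordEnvelopeR.StrategistR1

end
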